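import Literature.IUT.HodgeArakelov.ThetaEvaluationSettingModelOfProp15OfOrigin

/-!
# [IUTchII] Prop 2.2 (ii)′ at the MODEL — the (R2) class-level inversion binder in LIFT-TOLERANT (orbit) form
# (node IUTchII:Prop2.2(ii); GAP row G-w4d010-2 residual (R2), disposition D-G-w4d010-2f; CONE-L2-STATUS v3.5
# «instantiation needs a different lift (L6 consumers w4-d004/w4-d010)»)

S. Mochizuki, *Inter-universal Teichmüller theory II*, kurims manuscript (Dec. 2020) §2, Prop. 2.2 (ii) p. 66 l. 55–61
(«together with the condition of invariance with respect to `ι` … determines a specific `μ_{2l}`-orbit»; claim key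
`Mochizuki2012`, DISPUTED, D-0012), Rmk. 2.1.1 (i) p. 65 («the vertex labeled `0` is fixed by `ι_X`»), Rmk. 1.4.1 (ii)
p. 28 (the pointed inversion); S. Mochizuki, *The étale theta function …* [EtTh], Publ. RIMS **45** (2009) (refereed):
Prop. 1.4 (ii) PRIMS-render PDF p. 22 («`Θ̈(Ü) = −Θ̈(Ü⁻¹)`, `Θ̈(−Ü) = −Θ̈(Ü)`»), Thm. 1.6 (iii) p. 24 («some
`Π^tp_X/Π^tp_Y ≅ Z`-conjugate of the corresponding classes»), Prop. 1.5 (ii), (iii) p. 23, Def. 2.7 p. 41; [AbsAnab]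
Lem. 1.3.8 (FACT-LIST F-0007 `FundamentalExtension.PreservesGeom`). Pages = PRIMS journal PDF for [EtTh], kurims
preprint render IUTchII-kurims-url-5036b4059555 for [IUTchII].

PROOF-ONLY junction file (cell abc-iut, seat abc-iut-w4-d010 gen 11 — the node's END-TO-END assembler lineage; NO
definitions, NO `Prop`-valued facts, nothing landed is edited; every landed closer is consumed BY NAME).

WHY. Every NAMED-FACT-route closer of the μ_{2l}-clause of [IUTchII] Prop. 2.2 (ii) at `D := etaleThetaDataOfSetting'`
(`prop22_ii'_model_of_inversion_of_classLevel` p417690 → `…_of_inversion_of_prop15` p419369 → `…_of_prop15_of_origin` /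
`…_of_hinv[_over|_of_preservesGeom]_of_prop15_of_origin` p430763) carries the ONE open class-level binder in the
ε-PINNED shape `h14iota : autMap(ι|_{Π^tp_X̲̲}, ι^Θ)(η̈^Θ|_{Π^tp_Ÿ̲̲}) = ε · η̈^Θ|_{Π^tp_Ÿ̲̲}` (`ε` a deck element of
`Ÿ → Y`), which silently FIXES THE LIFT of the inversion inside its `Π^tp_X`-inner class to print's tangential one
(«`Θ̈(Ü⁻¹) = −Θ̈(Ü)`»; the lift «`Ü ↦ −Ü⁻¹`» FIXES `Θ̈`). But the (R2) transport it feeds — abc-iut-L2-t8's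
`hroot_of_coeffChange_root` — only consumes the ORBIT statement `∃ τ₀ ∈ Π^tp_Y̲̲, … = τ₀ · (…)` (this lineage chose
`τ₀ := ε`, `ThetaEvaluationSettingModelAssembly2.lean` l. 148–159). abc-iut-L2's board (CONE-L2-STATUS v3.5, row
EtTh:Prop1.4(ii)) records the FUNCTION-level package behind `h14iota` as REFUTED at `(modelχ, twistedInversion,
ConstCompat)` (abc-iut-w5-d125 `SettingModel.not_exists_package_modelχ_of_constCompat`, p447891) and that
«instantiation needs a different lift (L6 consumers)», while abc-iut-L2-d1 PROVED `ι_* η̈^Θ = η̈^Θ` ON THE NOSE for that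
lift (`SettingModel.transport_etaDdχ_twistedInversion`, `hιη_modelχ` with `τ := 1`; stage 2 `transport_etaDdχq`).

WHAT THIS FILE PROVES (same conclusions, every other hypothesis byte-identical to the landed closers):
* `prop22_ii'_model_of_inversion_of_classLevel_orbit` — the class-level closer with `h14iota` REPLACED by
  **`h14orbit : ∃ τ₀ : Π^tp_X̲̲, τ₀ ∈ Π^tp_Y ∧ autMap(ι|, ι^Θ)(η̈^Θ|_{Π^tp_Ÿ̲̲}) = τ₀ · η̈^Θ|_{Π^tp_Ÿ̲̲}`** («the POINTED
  inversion carries the restricted étale theta class into its `Π^tp_Y̲̲`-orbit `{η̈|, ε·η̈|}`» = [IUTchII] Rmk. 2.1.1 (i)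
  + [EtTh] Prop. 1.4 (ii) / Thm. 1.6 (iii) at `γ := ι`), and its FIXED-LIFT specialisation `…_of_classLevel_fixed`
  (`h14fix : autMap(ι|, ι^Θ)(η̈^Θ|) = η̈^Θ|`, i.e. `τ₀ := 1` — EXACTLY the shape abc-iut-L2-d1 proved at the χ-models);
* the NAMED-FACT-route closers in both shapes: `prop22_ii'_model_of_inversion_of_prop15_of_origin_orbit/_fixed`
  (companion-datum form) and `prop22_ii'_model_of_hinv_of_prop15_of_origin_orbit/_fixed` (over `G_K`: `hΔ := map_deltaTemp_eq_of_aug_conj …`),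
  `…_of_hinv_of_preservesGeom_of_prop15_of_origin_orbit` (ι-datum-reduced
  forms, abc-iut-w5-d072 / abc-iut-w4-d014 reductions by name);
* `h14orbit_of_h14iota` — the landed ε-pinned binder is the instance `τ₀ := ε` (so nothing landed is weakened away).

RESULT. On the NAMED-FACT route the μ_{2l}-clause closers of node IUTchII:Prop2.2(ii) are modulo EXACTLY: the model
inputs (`C`, `hC`, `hS`, (H1) `hchar`, `S`, `eS`, `hl`); the ι-DATUM {`ι`, `hι`, `hΔ` | `a`/`haug` | the F-0007
instance, `hq`, `δ`/`hιι`, `hinv`} (resp. {`c`, `hZ`, `hβ`} in companion form) for ANY lift `ι` of the pointed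
inversion; ONE class-level statement `h14orbit` (or `h14fix` for a lift fixing `η̈^Θ|`); and the FACT-LIST facts
F-2498 `IsEtThOrigin`, F-0591 `Prop15iii`, F-2503 `Prop15ii`. The deck element `ε` is no longer tied to the lift.
Honest framing: `h14orbit`/`h14fix` is still the class-level content of [EtTh] Prop. 1.4 (ii) / Thm. 1.6 (iii) at the
inversion — a HYPOTHESIS here (plan ruling C-R25 (iv): an L2 proof row), now in the shape abc-iut-L2-d1's model
theorems witness; every input about `ι` and every [EtTh] named fact stays a hypothesis; nothing here bears on
[IUTchIII] Cor. 3.12. [claim: Mochizuki2012, status: disputed] typed ≠ proved.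
-/

namespace Literature.IUT.HodgeArakelov

open Literature.AnabelianGeometry.EtaleTheta (ContH1 ThetaSetting)
open Literature.AnabelianGeometry.EtaleTheta Literature.AnabelianGeometry.AbsoluteAnabelian
open Literature.AnabelianGeometry.SemiGraphs (GQp)
open EtaleThetaDataOfSetting CohomologySystemOfContH1
open _root_.Topology
open scoped commutatorElement

noncomputable section

namespace EtaleThetaDataOfSetting

variable {p : ℕ} [Fact p.Prime] {D : Literature.AnabelianGeometry.EtaleTheta.ThetaSetting p}
  {E : D.EtaleThetaData} {l : ℕ} (C : E.DoubleUnderline l)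

/-! ## §1. The class-level closer with the (R2) inversion binder in ORBIT form -/

section Companion

variable (ι : D.PiTemp ≃ₜ* D.PiTemp) (hι : C.Huu.map ι.toMulEquiv.toMonoidHom = C.Huu)
  (c : ThetaSetting.ThetaCompanion ι)

/-- The landed ε-PINNED binder `h14iota` («`ι` carries `η̈^Θ|` to its `ε`-conjugate», abc-iut-w4-d010 p417690 /
abc-iut-L2-t8 p419369) is the instance `τ₀ := ε` of the ORBIT binder `h14orbit` — recorded so that every landed
ε-pinned closer is visibly a special case of the orbit-form closers below. [cite: MochizukiEtTh2009, Prop 1.4 (ii) p.22] -/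
theorem h14orbit_of_h14iota [(PiYdd C).Normal] (hchar : PiYddCharacteristic C) (ε : Pi C) (hε₁ : (ε : D.PiTemp) ∈ D.GtpY)
    (h14iota : ContH1Aut.autMap (phi C) D.DeltaTheta (inversionAlpha C ι hι) c.thetaIso
        (thetaCompanion_phi C ι hι c) (thetaCompanion_mem_deltaTheta ι c)
        (symm_mem_inf_top (PiYdd C) (inversionAlpha C ι hι) (mem_PiYdd_iff_of_piYddCharacteristic C hchar _))
        (ContH1.comap D.toTheta D.DeltaTheta C.Huu.subtype continuous_subtype_val
          (map_subtype_piYdd_inf_le_GtpYdd C ⊤) E.etaDd) =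
      ContH1.conj (phi C) D.DeltaTheta ε
        (ContH1.comap D.toTheta D.DeltaTheta C.Huu.subtype continuous_subtype_val
          (map_subtype_piYdd_inf_le_GtpYdd C ⊤) E.etaDd)) :
    ∃ τ₀ : Pi C, (τ₀ : D.PiTemp) ∈ D.GtpY ∧
      ContH1Aut.autMap (phi C) D.DeltaTheta (inversionAlpha C ι hι) c.thetaIso
        (thetaCompanion_phi C ι hι c) (thetaCompanion_mem_deltaTheta ι c)
        (symm_mem_inf_top (PiYdd C) (inversionAlpha C ι hι) (mem_PiYdd_iff_of_piYddCharacteristic C hchar _))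
        (ContH1.comap D.toTheta D.DeltaTheta C.Huu.subtype continuous_subtype_val
          (map_subtype_piYdd_inf_le_GtpYdd C ⊤) E.etaDd) =
      ContH1.conj (phi C) D.DeltaTheta τ₀
        (ContH1.comap D.toTheta D.DeltaTheta C.Huu.subtype continuous_subtype_val
          (map_subtype_piYdd_inf_le_GtpYdd C ⊤) E.etaDd) :=
  ⟨ε, hε₁, h14iota⟩

/-- A FIXED-LIFT binder `h14fix` («this lift of the inversion FIXES `η̈^Θ|_{Π^tp_Ÿ̲̲}`» — the shape abc-iut-L2-d1 proved at
the χ-models, `SettingModel.transport_etaDdχ_twistedInversion` / `hιη_modelχ` with `τ := 1`) is the instance `τ₀ := 1`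
of the ORBIT binder `h14orbit`. [cite: MochizukiEtTh2009, Thm 1.6 (iii) p.24] -/
theorem h14orbit_of_h14fix [(PiYdd C).Normal] (hchar : PiYddCharacteristic C)
    (h14fix : ContH1Aut.autMap (phi C) D.DeltaTheta (inversionAlpha C ι hι) c.thetaIso
        (thetaCompanion_phi C ι hι c) (thetaCompanion_mem_deltaTheta ι c)
        (symm_mem_inf_top (PiYdd C) (inversionAlpha C ι hι) (mem_PiYdd_iff_of_piYddCharacteristic C hchar _))
        (ContH1.comap D.toTheta D.DeltaTheta C.Huu.subtype continuous_subtype_val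
          (map_subtype_piYdd_inf_le_GtpYdd C ⊤) E.etaDd) =
      ContH1.comap D.toTheta D.DeltaTheta C.Huu.subtype continuous_subtype_val
        (map_subtype_piYdd_inf_le_GtpYdd C ⊤) E.etaDd) :
    ∃ τ₀ : Pi C, (τ₀ : D.PiTemp) ∈ D.GtpY ∧
      ContH1Aut.autMap (phi C) D.DeltaTheta (inversionAlpha C ι hι) c.thetaIso
        (thetaCompanion_phi C ι hι c) (thetaCompanion_mem_deltaTheta ι c)
        (symm_mem_inf_top (PiYdd C) (inversionAlpha C ι hι) (mem_PiYdd_iff_of_piYddCharacteristic C hchar _))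
        (ContH1.comap D.toTheta D.DeltaTheta C.Huu.subtype continuous_subtype_val
          (map_subtype_piYdd_inf_le_GtpYdd C ⊤) E.etaDd) =
      ContH1.conj (phi C) D.DeltaTheta τ₀
        (ContH1.comap D.toTheta D.DeltaTheta C.Huu.subtype continuous_subtype_val
          (map_subtype_piYdd_inf_le_GtpYdd C ⊤) E.etaDd) := by
  refine ⟨1, ?_, ?_⟩
  · rw [OneMemClass.coe_one]
    exact one_mem _
  · rw [h14fix, ContH1.conj_one_apply]

/-- **IUTchII:Prop2.2(ii)′ at the model `Π_v := Π^tp_X̲̲`, (R2) inversion binder in ORBIT form** (kurims p. 66: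
«determines a specific `μ_{2l}`-orbit `θ^ι(Π_v) ⊆ θ(Π_v)` within the unique `{(l·ℤ)×μ_{2l}}`-orbit»): abc-iut-w4-d010's
`prop22_ii'_model_of_inversion_of_classLevel` (p417690) with the ε-pinned class-level binder `h14iota` REPLACED by
`h14orbit : ∃ τ₀ ∈ Π^tp_X̲̲ ∩ Π^tp_Y, autMap(ι|_{Π^tp_X̲̲}, ι^Θ)(η̈^Θ|_{Π^tp_Ÿ̲̲}) = τ₀ · η̈^Θ|_{Π^tp_Ÿ̲̲}` — «the pointed
inversion ([IUTchII] Rmk. 2.1.1 (i): it fixes the vertex labeled `0`) carries the restricted étale theta class into its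
`Π^tp_Y̲̲`-orbit» ([EtTh] Prop. 1.4 (ii) + Thm. 1.6 (iii) at `γ := ι`), which no longer pins WHICH lift of the inversion
inside its `Π^tp_X`-inner class is meant; all other inputs — the model data, (R1) `ι`/`hι`/companion `c`/`hZ`/`δ`,`hιι`/`hβ`,
the deck element `ε` (used by `h14sign` only), `h14sign`, `h14free` — are byte-identical. PROOF: the landed proof, whose
(R2) transport `hroot_of_coeffChange_root` (abc-iut-L2-t8) consumes exactly the orbit statement.
[claim: Mochizuki2012, status: disputed] (IUTchII §2 Prop 2.2 (ii), kurims pp.65-67) -/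
theorem prop22_ii'_model_of_inversion_of_classLevel_orbit [hN : (PiYdd C).Normal] [hYN : D.GtpYdd.Normal]
    (hC : D.Compat) (hS : D.Sec2Hyps) (hchar : PiYddCharacteristic C) (S : BadPlaceSetting.{0})
    (eS : (Pi C) ≃ₜ* S.PiX) (hl : S.l = l) {T₀ : TemperedCoverings S (Pi C)}
    (Dec : SubgraphDecomposition S T₀ (etaleThetaDataOfSetting' C hC hS hchar S.toThetaSetting eS hl))
    -- (R1) the inversion datum
    (γ ε : Pi C) (hγ : C.toLZ γ = Multiplicative.ofAdd 1) (hε₁ : (ε : D.PiTemp) ∈ D.GtpY)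
    (hε₂ : (ε : D.PiTemp) ∉ D.GtpYdd) (hZ : D.toZ (ι (γ : D.PiTemp)) = (D.toZ (γ : D.PiTemp))⁻¹)
    (δ : Pi C) (hιι : ∀ x : Pi C, ι (ι (x : D.PiTemp)) = (δ : D.PiTemp) * (x : D.PiTemp) * (δ : D.PiTemp)⁻¹)
    (hβ : ∀ a : D.GtpTheta, a ∈ D.DeltaTheta → c.thetaIso a * a⁻¹ ∈ D.lDeltaTheta l)
    -- (R2)/(R3) [EtTh] Prop. 1.4 at the Δ_Θ-class level on `η̈^Θ`, the inversion clause in ORBIT form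
    (h14sign : ∃ κ₁ : ContH1 D.toTheta D.DeltaTheta D.GtpYdd, κ₁ ^ 2 = 1 ∧
      ContH1.conj D.toTheta D.DeltaTheta (ε : D.PiTemp) E.etaDd = E.etaDd * κ₁)
    (h14orbit : ∃ τ₀ : Pi C, (τ₀ : D.PiTemp) ∈ D.GtpY ∧
      ContH1Aut.autMap (phi C) D.DeltaTheta (inversionAlpha C ι hι) c.thetaIso
        (thetaCompanion_phi C ι hι c) (thetaCompanion_mem_deltaTheta ι c)
        (symm_mem_inf_top (PiYdd C) (inversionAlpha C ι hι) (mem_PiYdd_iff_of_piYddCharacteristic C hchar _))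
        (ContH1.comap D.toTheta D.DeltaTheta C.Huu.subtype continuous_subtype_val
          (map_subtype_piYdd_inf_le_GtpYdd C ⊤) E.etaDd) =
      ContH1.conj (phi C) D.DeltaTheta τ₀
        (ContH1.comap D.toTheta D.DeltaTheta C.Huu.subtype continuous_subtype_val
          (map_subtype_piYdd_inf_le_GtpYdd C ⊤) E.etaDd))
    (h14free : ∀ k : ℤ, k ≠ 0 → ¬ IsOfFinOrder
      (ContH1.comap D.toTheta D.DeltaTheta C.Huu.subtype continuous_subtype_val
        (map_subtype_piYdd_inf_le_GtpYdd C ⊤)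
        (ContH1.conj D.toTheta D.DeltaTheta ((γ : D.PiTemp) ^ k) E.etaDd * E.etaDd⁻¹))) :
    Prop22_ii' Dec := by
  -- the pair and its bookkeeping, under the NAMES of abc-iut-w5-d072
  have hφ := thetaCompanion_phi C ι hι c
  have hA : ∀ a : D.GtpTheta, a ∈ D.lDeltaTheta l → c.thetaIso a ∈ D.lDeltaTheta l :=
    fun a ha => (mem_lDeltaTheta_iff_thetaCompanion ι c l a).mp ha
  have hH := mem_PiYdd_iff_of_piYddCharacteristic C hchar (inversionAlpha C ι hι)
  -- (R2) hsign and (R3) hfree / hfreeK at the root-class level (abc-iut-L2-t8's transports)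
  have hsign := hsign_of_etaDd_sign C hS ε hε₁ h14sign
  have hfreeK := not_isOfFinOrder_translate_of_etaDd C γ h14free
  have hfree := hfree_of_etaDd_free C γ h14free
  -- (R2) hroot: the Δ_Θ-image of `T η̲̈` lies in the `Π^tp_Y̲̲`-orbit of the Δ_Θ-image of `η̲̈`
  have hΔ : ∃ τ₀ : Pi C, (τ₀ : D.PiTemp) ∈ D.GtpY ∧
      ContH1.coeffChange (phi C) (D.lDeltaTheta_le l) (PiYdd C ⊓ ⊤)
          (h1TopAut (phi C) (D.lDeltaTheta l) (PiYdd C) (inversionAlpha C ι hι) c.thetaIso hφ hA hH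
            (rootLiftClass C)) =
        ContH1.conj (phi C) D.DeltaTheta τ₀
          (ContH1.coeffChange (phi C) (D.lDeltaTheta_le l) (PiYdd C ⊓ ⊤) (rootLiftClass C)) := by
    obtain ⟨τ₀, hτ₀, h⟩ := h14orbit
    refine ⟨τ₀, hτ₀, ?_⟩
    rw [coeffChange_h1TopAut (phi C) (D.lDeltaTheta_le l) (PiYdd C) (inversionAlpha C ι hι) c.thetaIso hφ hA hH
        (thetaCompanion_mem_deltaTheta ι c), coeffChange_rootLiftClass_eq_comap, h1TopAut_apply]
    exact h
  have hroot := hroot_of_coeffChange_root C (inversionAlpha C ι hι) c.thetaIso hφ hA hH hS γ ε hγ hε₁ hε₂ hsign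
    hfreeK δ (inversionAlpha_apply_apply_eq_conj C ι hι δ hιι) hβ hΔ
  exact prop22_ii'_model_of_inversion C ι hι c hC hS hchar S eS hl Dec γ ε hγ hε₁ hε₂ hZ hsign hroot hfree

/-- **IUTchII:Prop2.2(ii)′ at the model, (R2) inversion binder in FIXED-LIFT form** (kurims p. 66): as
`prop22_ii'_model_of_inversion_of_classLevel_orbit` with `h14fix : autMap(ι|, ι^Θ)(η̈^Θ|_{Π^tp_Ÿ̲̲}) = η̈^Θ|_{Π^tp_Ÿ̲̲}`
(`τ₀ := 1`) — the lift of the inversion that FIXES the restricted étale theta class («`Ü ↦ −Ü⁻¹`»: `Θ̈(−Ü⁻¹) = Θ̈(Ü)` by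
[EtTh] Prop. 1.4 (ii); at the χ-models: abc-iut-L2-d1's `transport_etaDdχ_twistedInversion`).
[claim: Mochizuki2012, status: disputed] (IUTchII §2 Prop 2.2 (ii), kurims pp.65-67) -/
theorem prop22_ii'_model_of_inversion_of_classLevel_fixed [hN : (PiYdd C).Normal] [hYN : D.GtpYdd.Normal]
    (hC : D.Compat) (hS : D.Sec2Hyps) (hchar : PiYddCharacteristic C) (S : BadPlaceSetting.{0})
    (eS : (Pi C) ≃ₜ* S.PiX) (hl : S.l = l) {T₀ : TemperedCoverings S (Pi C)}
    (Dec : SubgraphDecomposition S T₀ (etaleThetaDataOfSetting' C hC hS hchar S.toThetaSetting eS hl))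
    (γ ε : Pi C) (hγ : C.toLZ γ = Multiplicative.ofAdd 1) (hε₁ : (ε : D.PiTemp) ∈ D.GtpY)
    (hε₂ : (ε : D.PiTemp) ∉ D.GtpYdd) (hZ : D.toZ (ι (γ : D.PiTemp)) = (D.toZ (γ : D.PiTemp))⁻¹)
    (δ : Pi C) (hιι : ∀ x : Pi C, ι (ι (x : D.PiTemp)) = (δ : D.PiTemp) * (x : D.PiTemp) * (δ : D.PiTemp)⁻¹)
    (hβ : ∀ a : D.GtpTheta, a ∈ D.DeltaTheta → c.thetaIso a * a⁻¹ ∈ D.lDeltaTheta l)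
    (h14sign : ∃ κ₁ : ContH1 D.toTheta D.DeltaTheta D.GtpYdd, κ₁ ^ 2 = 1 ∧
      ContH1.conj D.toTheta D.DeltaTheta (ε : D.PiTemp) E.etaDd = E.etaDd * κ₁)
    (h14fix : ContH1Aut.autMap (phi C) D.DeltaTheta (inversionAlpha C ι hι) c.thetaIso
        (thetaCompanion_phi C ι hι c) (thetaCompanion_mem_deltaTheta ι c)
        (symm_mem_inf_top (PiYdd C) (inversionAlpha C ι hι) (mem_PiYdd_iff_of_piYddCharacteristic C hchar _))
        (ContH1.comap D.toTheta D.DeltaTheta C.Huu.subtype continuous_subtype_val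
          (map_subtype_piYdd_inf_le_GtpYdd C ⊤) E.etaDd) =
      ContH1.comap D.toTheta D.DeltaTheta C.Huu.subtype continuous_subtype_val
        (map_subtype_piYdd_inf_le_GtpYdd C ⊤) E.etaDd)
    (h14free : ∀ k : ℤ, k ≠ 0 → ¬ IsOfFinOrder
      (ContH1.comap D.toTheta D.DeltaTheta C.Huu.subtype continuous_subtype_val
        (map_subtype_piYdd_inf_le_GtpYdd C ⊤)
        (ContH1.conj D.toTheta D.DeltaTheta ((γ : D.PiTemp) ^ k) E.etaDd * E.etaDd⁻¹))) :
    Prop22_ii' Dec :=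
  prop22_ii'_model_of_inversion_of_classLevel_orbit C ι hι c hC hS hchar S eS hl Dec γ ε hγ hε₁ hε₂ hZ δ hιι hβ
    h14sign (h14orbit_of_h14fix C ι hι c hchar h14fix) h14free

/-! ## §2. The NAMED-FACT route, companion-datum form (abc-iut-L2-t8 p419369 / this lineage p430763), orbit / fixed -/

/-- **IUTchII:Prop2.2(ii)′ at the model on the [EtTh] §1 NAMED-FACT route, companion form, (R2) in ORBIT form** (kurims
p. 66): `Prop22_ii' Dec` GIVEN EXACTLY the model data; the (R1) inversion datum (`ι` with `ι(Π^tp_X̲̲) = Π^tp_X̲̲`, theta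
companion `c`, `ℤ`-reversal `hZ` at the `toLZ`-generator `γ`, `ι² = conj δ` on `Π^tp_X̲̲`, `ι ≡ +1` on `Δ_Θ/l·Δ_Θ`, a deck
element `ε ∈ Π^tp_Y ∖ Π^tp_Ÿ`); the ORBIT binder `h14orbit`; and the named §1 facts `Prop15iii` (F-0591), `Prop15ii`
(F-2503), `IsEtThOrigin` (F-2498) — this lineage's `prop22_ii'_model_of_inversion_of_prop15_of_origin` (p430763) with
`h14iota` replaced by `h14orbit`. [claim: Mochizuki2012, status: disputed] (IUTchII §2 Prop 2.2 (ii), kurims p.66) -/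
theorem prop22_ii'_model_of_inversion_of_prop15_of_origin_orbit [(PiYdd C).Normal] [D.GtpYdd.Normal]
    (hC : D.Compat) (hS : D.Sec2Hyps) (hchar : PiYddCharacteristic C) (S : BadPlaceSetting.{0})
    (eS : (Pi C) ≃ₜ* S.PiX) (hl : S.l = l) {T₀ : TemperedCoverings S (Pi C)}
    (Dec : SubgraphDecomposition S T₀ (etaleThetaDataOfSetting' C hC hS hchar S.toThetaSetting eS hl))
    -- (R1) the inversion datum
    (γ ε : Pi C) (hγ : C.toLZ γ = Multiplicative.ofAdd 1) (hε₁ : (ε : D.PiTemp) ∈ D.GtpY)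
    (hε₂ : (ε : D.PiTemp) ∉ D.GtpYdd) (hZ : D.toZ (ι (γ : D.PiTemp)) = (D.toZ (γ : D.PiTemp))⁻¹)
    (δ : Pi C) (hιι : ∀ x : Pi C, ι (ι (x : D.PiTemp)) = (δ : D.PiTemp) * (x : D.PiTemp) * (δ : D.PiTemp)⁻¹)
    (hβ : ∀ a : D.GtpTheta, a ∈ D.DeltaTheta → c.thetaIso a * a⁻¹ ∈ D.lDeltaTheta l)
    -- (R2) the class-level inversion statement in ORBIT form, still a binder
    (h14orbit : ∃ τ₀ : Pi C, (τ₀ : D.PiTemp) ∈ D.GtpY ∧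
      ContH1Aut.autMap (phi C) D.DeltaTheta (inversionAlpha C ι hι) c.thetaIso
        (thetaCompanion_phi C ι hι c) (thetaCompanion_mem_deltaTheta ι c)
        (symm_mem_inf_top (PiYdd C) (inversionAlpha C ι hι) (mem_PiYdd_iff_of_piYddCharacteristic C hchar _))
        (ContH1.comap D.toTheta D.DeltaTheta C.Huu.subtype continuous_subtype_val
          (map_subtype_piYdd_inf_le_GtpYdd C ⊤) E.etaDd) =
      ContH1.conj (phi C) D.DeltaTheta τ₀
        (ContH1.comap D.toTheta D.DeltaTheta C.Huu.subtype continuous_subtype_val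
          (map_subtype_piYdd_inf_le_GtpYdd C ⊤) E.etaDd))
    -- the [EtTh] §1 named facts (no `hL`)
    (hO : D.IsEtThOrigin) (h15 : ThetaSetting.Prop15iii E hC) (h15ii : ThetaSetting.Prop15ii E.toKummerData hC) :
    Prop22_ii' Dec :=
  prop22_ii'_model_of_inversion_of_classLevel_orbit C ι hι c hC hS hchar S eS hl Dec γ ε hγ hε₁ hε₂ hZ δ hιι hβ
    (h14sign_of_prop15iii C hC hS h15 ε hε₁) h14orbit (h14free_of_prop15_of_origin C hC hO h15 h15ii γ hγ)

/-- **IUTchII:Prop2.2(ii)′ at the model on the NAMED-FACT route, companion form, (R2) in FIXED-LIFT form** (kurims p. 66):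
as `prop22_ii'_model_of_inversion_of_prop15_of_origin_orbit` with `h14fix` («this lift FIXES `η̈^Θ|_{Π^tp_Ÿ̲̲}`»,
`τ₀ := 1`). [claim: Mochizuki2012, status: disputed] (IUTchII §2 Prop 2.2 (ii), kurims p.66) -/
theorem prop22_ii'_model_of_inversion_of_prop15_of_origin_fixed [(PiYdd C).Normal] [D.GtpYdd.Normal]
    (hC : D.Compat) (hS : D.Sec2Hyps) (hchar : PiYddCharacteristic C) (S : BadPlaceSetting.{0})
    (eS : (Pi C) ≃ₜ* S.PiX) (hl : S.l = l) {T₀ : TemperedCoverings S (Pi C)}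
    (Dec : SubgraphDecomposition S T₀ (etaleThetaDataOfSetting' C hC hS hchar S.toThetaSetting eS hl))
    (γ ε : Pi C) (hγ : C.toLZ γ = Multiplicative.ofAdd 1) (hε₁ : (ε : D.PiTemp) ∈ D.GtpY)
    (hε₂ : (ε : D.PiTemp) ∉ D.GtpYdd) (hZ : D.toZ (ι (γ : D.PiTemp)) = (D.toZ (γ : D.PiTemp))⁻¹)
    (δ : Pi C) (hιι : ∀ x : Pi C, ι (ι (x : D.PiTemp)) = (δ : D.PiTemp) * (x : D.PiTemp) * (δ : D.PiTemp)⁻¹)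
    (hβ : ∀ a : D.GtpTheta, a ∈ D.DeltaTheta → c.thetaIso a * a⁻¹ ∈ D.lDeltaTheta l)
    (h14fix : ContH1Aut.autMap (phi C) D.DeltaTheta (inversionAlpha C ι hι) c.thetaIso
        (thetaCompanion_phi C ι hι c) (thetaCompanion_mem_deltaTheta ι c)
        (symm_mem_inf_top (PiYdd C) (inversionAlpha C ι hι) (mem_PiYdd_iff_of_piYddCharacteristic C hchar _))
        (ContH1.comap D.toTheta D.DeltaTheta C.Huu.subtype continuous_subtype_val
          (map_subtype_piYdd_inf_le_GtpYdd C ⊤) E.etaDd) =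
      ContH1.comap D.toTheta D.DeltaTheta C.Huu.subtype continuous_subtype_val
        (map_subtype_piYdd_inf_le_GtpYdd C ⊤) E.etaDd)
    (hO : D.IsEtThOrigin) (h15 : ThetaSetting.Prop15iii E hC) (h15ii : ThetaSetting.Prop15ii E.toKummerData hC) :
    Prop22_ii' Dec :=
  prop22_ii'_model_of_inversion_of_prop15_of_origin_orbit C ι hι c hC hS hchar S eS hl Dec γ ε hγ hε₁ hε₂ hZ δ hιι hβ
    (h14orbit_of_h14fix C ι hι c hchar h14fix) hO h15 h15ii

end Companion

/-! ## §3. The NAMED-FACT route, ι-datum-reduced forms (abc-iut-w5-d072 / abc-iut-w4-d014 reductions), orbit / fixed -/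

section Inversion

variable (ι : D.PiTemp ≃ₜ* D.PiTemp) (hι : C.Huu.map ι.toMulEquiv.toMonoidHom = C.Huu)

/-- **IUTchII:Prop2.2(ii)′ at the model on the NAMED-FACT route, ι-datum reduced, (R2) in ORBIT form** (kurims p. 66):
for a topological automorphism `ι` of `Π^tp_X` with `ι(Π^tp_X̲̲) = Π^tp_X̲̲` (`hι`), `ι(Δ^tp_X) = Δ^tp_X` (`hΔ`), `ι² = conj δ`
on `Π^tp_X̲̲` (`hιι`) and `ι̂ ≡ −1` on `Δ_X^ab` (`hinv`), the root-topology input `hq`, a deck element `ε ∈ Π^tp_Y ∖ Π^tp_Ÿ`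
(for the sign clause), the ORBIT binder `h14orbit` at the CONSTRUCTED theta companion `thetaCompanionOfAut ι hΔ hq`, and
the named facts `IsEtThOrigin` (F-2498), `Prop15iii` (F-0591), `Prop15ii` (F-2503) ONLY: `Prop22_ii' Dec` — this
lineage's `prop22_ii'_model_of_hinv_of_prop15_of_origin` (p430763) with `h14iota` replaced by `h14orbit` (`γ` from
`exists_translation_generators`, `hZ` from `toZ_inversion_generator_of_inversion`, `hβ` from
`thetaIso_mul_inv_mem_lDeltaTheta_of_inversion` — abc-iut-w5-d072 / abc-iut-w4-d014, by name). For `ι` OVER `G_K`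
(«`aug (ι x) = a·aug(x)·a⁻¹`») take `hΔ := D.map_deltaTemp_eq_of_aug_conj ι a haug` (abc-iut-w4-d014).
[claim: Mochizuki2012, status: disputed] (IUTchII §2 Prop 2.2 (ii), kurims pp.65-67) -/
theorem prop22_ii'_model_of_hinv_of_prop15_of_origin_orbit
    (hinv : ∀ g ∈ D.toTemperedCurve.DeltaHat, D.toTemperedCurve.completionAut ι g * g ∈
      (⁅D.toTemperedCurve.DeltaHat, D.toTemperedCurve.DeltaHat⁆).topologicalClosure)
    (hΔ : D.DeltaTemp.map ι.toMulEquiv.toMonoidHom = D.DeltaTemp) (hq : IsQuotientMap D.toTheta)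
    [hN : (PiYdd C).Normal] [hYN : D.GtpYdd.Normal] (hC : D.Compat) (hS : D.Sec2Hyps)
    (hchar : PiYddCharacteristic C) (S : BadPlaceSetting.{0}) (eS : (Pi C) ≃ₜ* S.PiX) (hl : S.l = l)
    {T₀ : TemperedCoverings S (Pi C)}
    (Dec : SubgraphDecomposition S T₀ (etaleThetaDataOfSetting' C hC hS hchar S.toThetaSetting eS hl))
    -- the deck element (sign clause) and `ι² = conj δ`
    (ε : Pi C) (hε₁ : (ε : D.PiTemp) ∈ D.GtpY) (hε₂ : (ε : D.PiTemp) ∉ D.GtpYdd)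
    (δ : Pi C) (hιι : ∀ x : Pi C, ι (ι (x : D.PiTemp)) = (δ : D.PiTemp) * (x : D.PiTemp) * (δ : D.PiTemp)⁻¹)
    -- (R2) the class-level inversion statement in ORBIT form at the constructed theta companion
    (h14orbit : ∃ τ₀ : Pi C, (τ₀ : D.PiTemp) ∈ D.GtpY ∧
      ContH1Aut.autMap (phi C) D.DeltaTheta (inversionAlpha C ι hι) (D.thetaCompanionOfAut ι hΔ hq).thetaIso
        (thetaCompanion_phi C ι hι (D.thetaCompanionOfAut ι hΔ hq))
        (thetaCompanion_mem_deltaTheta ι (D.thetaCompanionOfAut ι hΔ hq))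
        (symm_mem_inf_top (PiYdd C) (inversionAlpha C ι hι) (mem_PiYdd_iff_of_piYddCharacteristic C hchar _))
        (ContH1.comap D.toTheta D.DeltaTheta C.Huu.subtype continuous_subtype_val
          (map_subtype_piYdd_inf_le_GtpYdd C ⊤) E.etaDd) =
      ContH1.conj (phi C) D.DeltaTheta τ₀
        (ContH1.comap D.toTheta D.DeltaTheta C.Huu.subtype continuous_subtype_val
          (map_subtype_piYdd_inf_le_GtpYdd C ⊤) E.etaDd))
    -- the [EtTh] §1 named facts (no `hL`)
    (hO : D.IsEtThOrigin) (h15 : ThetaSetting.Prop15iii E hC) (h15ii : ThetaSetting.Prop15ii E.toKummerData hC) :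
    Prop22_ii' Dec := by
  -- a `toLZ`-generator `γ` of `Π^tp_X̲̲/Π^tp_Y̲̲ ≅ ℤ` exists (this lineage's `exists_translation_generators`)
  obtain ⟨γ, -, hγ, -, -⟩ := exists_translation_generators C hS
  exact prop22_ii'_model_of_inversion_of_classLevel_orbit C ι hι (D.thetaCompanionOfAut ι hΔ hq) hC hS hchar S eS hl
    Dec γ ε hγ hε₁ hε₂ (toZ_inversion_generator_of_inversion C ι hι hinv hS hchar γ hγ) δ hιι
    (ThetaSetting.ThetaCompanion.thetaIso_mul_inv_mem_lDeltaTheta_of_inversion D hinv _ l)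
    (h14sign_of_prop15iii C hC hS h15 ε hε₁) h14orbit (h14free_of_prop15_of_origin C hC hO h15 h15ii γ hγ)

/-- **IUTchII:Prop2.2(ii)′ at the model on the NAMED-FACT route, ι-datum reduced, (R2) in FIXED-LIFT form** (kurims
p. 66): as `prop22_ii'_model_of_hinv_of_prop15_of_origin_orbit` with `h14fix` (`τ₀ := 1`) at the constructed theta
companion. [claim: Mochizuki2012, status: disputed] (IUTchII §2 Prop 2.2 (ii), kurims pp.65-67) -/
theorem prop22_ii'_model_of_hinv_of_prop15_of_origin_fixed
    (hinv : ∀ g ∈ D.toTemperedCurve.DeltaHat, D.toTemperedCurve.completionAut ι g * g ∈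
      (⁅D.toTemperedCurve.DeltaHat, D.toTemperedCurve.DeltaHat⁆).topologicalClosure)
    (hΔ : D.DeltaTemp.map ι.toMulEquiv.toMonoidHom = D.DeltaTemp) (hq : IsQuotientMap D.toTheta)
    [hN : (PiYdd C).Normal] [hYN : D.GtpYdd.Normal] (hC : D.Compat) (hS : D.Sec2Hyps)
    (hchar : PiYddCharacteristic C) (S : BadPlaceSetting.{0}) (eS : (Pi C) ≃ₜ* S.PiX) (hl : S.l = l)
    {T₀ : TemperedCoverings S (Pi C)}
    (Dec : SubgraphDecomposition S T₀ (etaleThetaDataOfSetting' C hC hS hchar S.toThetaSetting eS hl))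
    (ε : Pi C) (hε₁ : (ε : D.PiTemp) ∈ D.GtpY) (hε₂ : (ε : D.PiTemp) ∉ D.GtpYdd)
    (δ : Pi C) (hιι : ∀ x : Pi C, ι (ι (x : D.PiTemp)) = (δ : D.PiTemp) * (x : D.PiTemp) * (δ : D.PiTemp)⁻¹)
    (h14fix : ContH1Aut.autMap (phi C) D.DeltaTheta (inversionAlpha C ι hι) (D.thetaCompanionOfAut ι hΔ hq).thetaIso
        (thetaCompanion_phi C ι hι (D.thetaCompanionOfAut ι hΔ hq))
        (thetaCompanion_mem_deltaTheta ι (D.thetaCompanionOfAut ι hΔ hq))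
        (symm_mem_inf_top (PiYdd C) (inversionAlpha C ι hι) (mem_PiYdd_iff_of_piYddCharacteristic C hchar _))
        (ContH1.comap D.toTheta D.DeltaTheta C.Huu.subtype continuous_subtype_val
          (map_subtype_piYdd_inf_le_GtpYdd C ⊤) E.etaDd) =
      ContH1.comap D.toTheta D.DeltaTheta C.Huu.subtype continuous_subtype_val
        (map_subtype_piYdd_inf_le_GtpYdd C ⊤) E.etaDd)
    (hO : D.IsEtThOrigin) (h15 : ThetaSetting.Prop15iii E hC) (h15ii : ThetaSetting.Prop15ii E.toKummerData hC) :
    Prop22_ii' Dec :=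
  prop22_ii'_model_of_hinv_of_prop15_of_origin_orbit C ι hι hinv hΔ hq hC hS hchar S eS hl Dec ε hε₁ hε₂ δ hιι
    (h14orbit_of_h14fix C ι hι (D.thetaCompanionOfAut ι hΔ hq) hchar h14fix) hO h15 h15ii

/-- **… for an ARBITRARY topological `ι` with `hΔ` BY NAME from [AbsAnab] Lem. 1.3.8** (FACT-LIST F-0007
`FundamentalExtension.PreservesGeom` at a fundamental extension `(F, eF)` modelling `Π_X ↠ G_K` — abc-iut-w4-d014's
`ThetaSetting.map_deltaTemp_eq_of_preservesGeom`), (R2) in ORBIT form; otherwise as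
`prop22_ii'_model_of_hinv_of_prop15_of_origin_orbit`. [claim: Mochizuki2012, status: disputed]
(IUTchII §2 Prop 2.2 (ii), kurims pp.65-67) -/
theorem prop22_ii'_model_of_hinv_of_preservesGeom_of_prop15_of_origin_orbit
    (hinv : ∀ g ∈ D.toTemperedCurve.DeltaHat, D.toTemperedCurve.completionAut ι g * g ∈
      (⁅D.toTemperedCurve.DeltaHat, D.toTemperedCurve.DeltaHat⁆).topologicalClosure)
    (F : FundamentalExtension.{0})
    (eF : F.arith ≃ₜ* D.PiHat) (heF : F.geom.map eF.toMulEquiv.toMonoidHom = D.DeltaHat)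
    (h138 : FundamentalExtension.PreservesGeom (F := F)
      (eF.trans ((D.toTemperedCurve.completionAut ι).trans eF.symm)))
    (hq : IsQuotientMap D.toTheta)
    [hN : (PiYdd C).Normal] [hYN : D.GtpYdd.Normal] (hC : D.Compat) (hS : D.Sec2Hyps)
    (hchar : PiYddCharacteristic C) (S : BadPlaceSetting.{0}) (eS : (Pi C) ≃ₜ* S.PiX) (hl : S.l = l)
    {T₀ : TemperedCoverings S (Pi C)}
    (Dec : SubgraphDecomposition S T₀ (etaleThetaDataOfSetting' C hC hS hchar S.toThetaSetting eS hl))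
    (ε : Pi C) (hε₁ : (ε : D.PiTemp) ∈ D.GtpY) (hε₂ : (ε : D.PiTemp) ∉ D.GtpYdd)
    (δ : Pi C) (hιι : ∀ x : Pi C, ι (ι (x : D.PiTemp)) = (δ : D.PiTemp) * (x : D.PiTemp) * (δ : D.PiTemp)⁻¹)
    (h14orbit : ∃ τ₀ : Pi C, (τ₀ : D.PiTemp) ∈ D.GtpY ∧
      ContH1Aut.autMap (phi C) D.DeltaTheta (inversionAlpha C ι hι)
        (D.thetaCompanionOfAut ι (D.map_deltaTemp_eq_of_preservesGeom ι F eF heF h138) hq).thetaIso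
        (thetaCompanion_phi C ι hι (D.thetaCompanionOfAut ι (D.map_deltaTemp_eq_of_preservesGeom ι F eF heF h138) hq))
        (thetaCompanion_mem_deltaTheta ι
          (D.thetaCompanionOfAut ι (D.map_deltaTemp_eq_of_preservesGeom ι F eF heF h138) hq))
        (symm_mem_inf_top (PiYdd C) (inversionAlpha C ι hι) (mem_PiYdd_iff_of_piYddCharacteristic C hchar _))
        (ContH1.comap D.toTheta D.DeltaTheta C.Huu.subtype continuous_subtype_val
          (map_subtype_piYdd_inf_le_GtpYdd C ⊤) E.etaDd) =
      ContH1.conj (phi C) D.DeltaTheta τ₀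
        (ContH1.comap D.toTheta D.DeltaTheta C.Huu.subtype continuous_subtype_val
          (map_subtype_piYdd_inf_le_GtpYdd C ⊤) E.etaDd))
    (hO : D.IsEtThOrigin) (h15 : ThetaSetting.Prop15iii E hC) (h15ii : ThetaSetting.Prop15ii E.toKummerData hC) :
    Prop22_ii' Dec :=
  prop22_ii'_model_of_hinv_of_prop15_of_origin_orbit C ι hι hinv (D.map_deltaTemp_eq_of_preservesGeom ι F eF heF h138)
    hq hC hS hchar S eS hl Dec ε hε₁ hε₂ δ hιι h14orbit hO h15 h15ii

end Inversion

end EtaleThetaDataOfSetting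

end

end Literature.IUT.HodgeArakelov
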